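import Summits.BirchSwinnertonDyer.BirchSwinnertonDyer.Theorems.ClassRecordThreeEulerHalvesAtThreeEichlerShimuraSurjectiveCongruenceDescent
import Summits.BirchSwinnertonDyer.BirchSwinnertonDyer.Theorems.ClassRecordThreeEulerHalvesAtThreeCartanCoverPrintClausesSurjectiveDivision
import Literature.NumberTheory.Automorphic.EichlerOrdersMatrixRat
import Literature.NumberTheory.Automorphic.BrandtDataRingEquiv
import Literature.RingTheory.CentralSimple.SkolemNoetherArtinianTarget
import HarnessLib

/-!
# (ESᶜ-surj-split) reduces to Eichler–Shimura surjectivity for the principal congruence subgroups `Γ(M)`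

Helper file of the BSD cell `bsd-stepL` (crux `EulerHalvesAtThree`, node `CartanOnePlaceDegreeLawAtThree`, line of record
`Cruxes/CartanOnePlaceDegreeLawAtThree/Lines/lattice.lean`). One of the print residues of that line is the named literature
fact (ESᶜ-surj-split) `Literature.NumberTheory.Automorphic.eichlerShimura_weightTwo_rePeriod_surjective_of_exists_not_isUnit`:
for every order `O` of a rational quaternion algebra `B` WITH A NON-ZERO NON-UNIT (`B ≅ M₂(ℚ)`), every embedding
`ι : B → M₂(ℝ)`, every base point `z₀` and every additive `u : Γ → ℝ` on `Γ = ι(O¹)` vanishing on parabolic elements, there is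
a weight-two cusp form `F` on `Γ` with `Re ∫_{z₀}^{γ z₀} F = u γ` for all `γ` (surjectivity in Shimura's Thm. 8.4, `n = 0`,
`Ψ = 1`, in the cusped case). This file proves, sorry-free, that the residue follows from the SAME surjectivity statement for
the principal congruence subgroups `Γ(M) ≤ SL₂(ℤ)` alone (the modular curves `X(M)`), indeed from any cofinal family of levels:

* `eichlerShimura_weightTwo_rePeriod_surjective_of_exists_not_isUnit_of_Gamma` —
  `(∀ N ≥ 1, ∃ M ≥ 1, N ∣ M ∧ ES-surj-par(Γ(M))) → eichlerShimura_weightTwo_rePeriod_surjective_of_exists_not_isUnit`;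
* `…_of_Gamma_three_le` — the same from `∀ M ≥ 3, ES-surj-par(Γ(M))` (torsion-free levels; `M = 3N`);
* `eichlerShimura_weightTwo_rePeriod_surjective_of_Gamma_three_le` — hence the full conjunct (ESᶜ-surj)
  `eichlerShimura_weightTwo_rePeriod_surjective` (division case = `eichlerShimura_weightTwo_rePeriod_surjective_of_split`, LEAD g29);
* `eichlerShimura_weightTwo_rePeriod_of_Gamma_three_le` — hence the whole real Eichler–Shimura conjunct (ESᶜ)
  `eichlerShimura_weightTwo_rePeriod` (split injectivity = `eichlerShimura_weightTwo_rePeriod_injective_of_exists_not_isUnit_holds`,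
  bsd-idea-10 g22; packaging `eichlerShimura_weightTwo_rePeriod_of_cusp_residue'`, LEAD g29).

* §4 `…_of_surjective_Gamma` (three theorems): the same three conclusions from the NAMED fact (ESᶜ-surj-Γ(M))
  `Literature.NumberTheory.Automorphic.eichlerShimura_weightTwo_rePeriod_surjective_Gamma` (`∀ M ≥ 3, ES-surj-par(Γ(M))`; defn-ty1 g45,
  p754197) — in particular `eichlerShimura_weightTwo_rePeriod_of_surjective_Gamma : eichlerShimura_weightTwo_rePeriod_surjective_Gamma →
  eichlerShimura_weightTwo_rePeriod`, which lets the line's cite stub carry (ESᶜ-surj-Γ(M)) instead of (ESᶜ-surj-split).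

Here ES-surj-par(`Γ`), for a subgroup `Γ ≤ GL₂(ℝ)`, is the statement written INLINE (no definition is introduced)
`∀ z₀ u, (∀ γ δ, u (γ δ) = u γ + u δ) → (∀ γ, γ parabolic → u γ = 0) → ∃ F : CuspForm Γ 2, ∀ γ, CuspForm.rePeriod F z₀ γ = u γ`,
and `Γ(M)` enters as the Mathlib level `(CongruenceSubgroup.Gamma M).map (Matrix.SpecialLinearGroup.mapGL ℝ)`.

## Proof chain

Part 1 (`…EichlerShimuraSurjectiveCongruenceDescent`): TRANSPORT `esSurjPar_conjAct_smul` (ES-surj-par passes from `Γ` to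
`g Γ g⁻¹`, `det g > 0`), DESCENT `esSurjPar_of_normal_finiteIndex` (from a normal finite-index subgroup, by averaging — the cell's
`CartanCoverPrintClausesDescentGeneral` argument with the pointwise hypothesis), and the group theory `conj_Gamma_le_normal_finiteIndex`.

Part 2 (this file) — THE SPLIT DICTIONARY `exists_conj_normOneUnits_dictionary`: if `B` has a non-zero non-unit then (Wedderburn,
`forall_isUnit_or_nonempty_algEquiv_matrix`) `φ : B ≅ M₂(ℚ)`; (Skolem–Noether with Artinian target,
`exists_units_forall_algHom_eq_conj_of_isArtinianRing`) `ι = u · (φ ⊗ ℝ) · u⁻¹` for some `u ∈ GL₂(ℝ)`; the order `φ(O)` lies in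
`g M₂(ℤ) g⁻¹` for some `g ∈ GL₂(ℚ)` (`Brandt.IsOrder.exists_le_map_unitsConj_matrixOrder`), where replacing `g` by `g · diag(-1,1)`
if necessary (`map_unitsConj_matrixOrder_eq_of_mem`) makes `det (u g) > 0`; and `g⁻¹ φ(O) g ⊇ N · M₂(ℤ)` for some `N ≥ 1`
(`exists_smul_mem_of_fg`). With `h = u g`: (i) every `γ ∈ ι(O¹)` is `h t h⁻¹` with `t ∈ SL₂(ℤ)`
(`exists_eq_map_intCast_of_mem_matrixOrder`, determinant by cast injectivity); (ii) `h s h⁻¹ ∈ ι(O¹)` for all `s ∈ Γ(M)`, `N ∣ M`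
(`s = 1 + M k`, so `φ⁻¹(g s g⁻¹) = 1 + φ⁻¹(g (N·((M/N) k)) g⁻¹) ∈ O`). Then part 1 gives `h Γ(M) h⁻¹ ⊴ ι(O¹)` of finite index, and
§3 = dictionary + transport along `h` + descent along `h Γ(M) h⁻¹ ⊴ ι(O¹)`.

## What this buys (numbers)

The residue (ESᶜ-surj-split) quantifies over all orders of all split `B` and all `ι`; after this file the only input left
is surjectivity of `F ↦ (γ ↦ Re ∫ F)` from `S₂(Γ(M))` onto the parabolic-null additive homomorphisms `Γ(M) → ℝ` for the
principal congruence subgroups `Γ(M)`, `M ≥ 3` — Shimura's Thm. 8.4 for the modular curve `X(M)` verbatim (genus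
`g = 1 + [PSL₂(ℤ):Γ̄(M)](M-6)/(12M)`, `dim_ℝ S₂(Γ(M)) = 2g = dim Hom_par(Γ(M), ℝ)`, Shimura (1.6.4) and Thm. 2.24 / 8.4).
No statement about `B`, orders, Skolem–Noether or commensurability remains in the residue.

## Deviations from print

Shimura §9.2 p. 246 treats the split case by «`Γ` is commensurable with `SL₂(ℤ)` up to conjugation»; commensurability is
not enough for a descent of cusp forms WITH prescribed periods, so the file proves the sharper (and equally classical)
statement that `ι(O¹)` contains a CONJUGATE OF A PRINCIPAL CONGRUENCE SUBGROUP AS A NORMAL SUBGROUP OF FINITE INDEX, by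
sandwiching `N M₂(ℤ) ⊆ g⁻¹ φ(O) g ⊆ M₂(ℤ)`. The sign adjustment `g ↦ g·diag(-1,1)` is needed because `CuspForm.translate`
and `segmentIntegral_slash_eq` are stated for `GL₂⁺(ℝ)`, while Skolem–Noether only gives `u ∈ GL₂(ℝ)`.

## References

* [ShimuraIATAF1971] G. Shimura, Introduction to the Arithmetic Theory of Automorphic Functions (1971): Prop. 1.19,
  §1.6 p. 22, Thm. 8.4 p. 234 with (8.2.19)–(8.2.20), §9.2 p. 246.
* [VignerasLNM800] M.-F. Vignéras, Arithmétique des algèbres de quaternions, LNM 800 (1980): Ch. I §4, Ch. IV §1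
  Thm. 1.1 p. 104 and Prop. 1.4 p. 105.
* [BourbakiAlgebreVIII2012] N. Bourbaki, Algèbre, Ch. VIII (2012): §14 n°3 Th. 2 and Corollaire (p. A VIII.252).
* [Voight2021] J. Voight, Quaternion Algebras, GTM 288 (2021): Main Thm. 5.4.4 (split ⇔ `≅ M₂(F)`), Main Thm. 7.7.1 and
  Cor. 7.7.3 (Skolem–Noether), 10.5.1–10.5.5 (orders of `M₂` over a PID lie in a conjugate of `M₂(R)`).
* [DiamondShurman2005] F. Diamond, J. Shurman, A First Course in Modular Forms (2005): §1.2 (`Γ(N)`), Thm. 3.1.1 / Fig. 3.4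
  (genus and `dim S₂(Γ(N))`).

No summit statement is proved by this file; BSD is proved for no curve.
-/

set_option linter.dupNamespace false
set_option autoImplicit false

noncomputable section

open scoped MatrixGroups ModularForm Pointwise
open ConjAct

namespace Summit.BirchSwinnertonDyer.BirchSwinnertonDyer.Theorems.EichlerShimuraCongruence

open Literature.NumberTheory.Automorphic
open Summit.BirchSwinnertonDyer.BirchSwinnertonDyer.Theorems.CartanCover.PrintClauses

/-! ## §2 The split dictionary: `B ≅ M₂(ℚ)`, the order inside `g M₂(ℤ) g⁻¹`, Skolem–Noether, and `h Γ(M) h⁻¹ ⊴ ι(O¹)` -/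

section Split

variable {B : Type} [Ring B] [Algebra ℚ B] {O : Submodule ℤ B} (hO : Brandt.IsOrder B O)
  (ι : B →ₐ[ℚ] Matrix (Fin 2) (Fin 2) ℝ)

/-- A quaternion algebra over `ℚ` with a non-zero non-unit is `≅ M₂(ℚ)` (Wedderburn; tree
`forall_isUnit_or_nonempty_algEquiv_matrix`). [folklore] -/
theorem nonempty_algEquiv_matrix_of_exists_not_isUnit [IsQuaternionAlgebra ℚ B] (hsplit : ∃ x : B, x ≠ 0 ∧ ¬ IsUnit x) :
    Nonempty (B ≃ₐ[ℚ] Matrix (Fin 2) (Fin 2) ℚ) := by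
  rcases forall_isUnit_or_nonempty_algEquiv_matrix ℚ B with h | h
  · obtain ⟨x, hx0, hx⟩ := hsplit
    exact absurd (h x hx0) hx
  · exact h

/-- **Skolem–Noether for `ι` against `φ ⊗ ℝ`**: for `φ : B ≅ M₂(ℚ)` and ANY `ℚ`-algebra map `ι : B → M₂(ℝ)` there is
`u ∈ GL₂(ℝ)` with `ι(b) = u φ(b) u⁻¹` (Bourbaki VIII §14 n°3 Th. 2 Cor., central simple source `B`, Artinian target `M₂(ℝ)`;
tree `exists_units_forall_algHom_eq_conj_of_isArtinianRing`). [cite: BourbakiAlgebreVIII2012, VIII §14 n°3 Th. 2, Corollaire (p. A VIII.252)] -/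
theorem exists_units_forall_eq_conj_map [IsQuaternionAlgebra ℚ B] (φ : B ≃ₐ[ℚ] Matrix (Fin 2) (Fin 2) ℚ) :
    ∃ u : GL (Fin 2) ℝ, ∀ b : B, ι b = (u : Matrix (Fin 2) (Fin 2) ℝ) * (φ b).map (Rat.castHom ℝ) *
      ((u⁻¹ : GL (Fin 2) ℝ) : Matrix (Fin 2) (Fin 2) ℝ) := by
  haveI := IsQuaternionAlgebra.isSimpleRing' ℚ B
  haveI : IsArtinianRing (Matrix (Fin 2) (Fin 2) ℝ) := IsArtinianRing.of_finite ℝ _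
  let f : B →ₐ[ℚ] Matrix (Fin 2) (Fin 2) ℝ :=
    ((Algebra.ofId ℚ ℝ).mapMatrix : Matrix (Fin 2) (Fin 2) ℚ →ₐ[ℚ] Matrix (Fin 2) (Fin 2) ℝ).comp
      (φ : B →ₐ[ℚ] Matrix (Fin 2) (Fin 2) ℚ)
  have hf : ∀ b : B, f b = (φ b).map (Rat.castHom ℝ) := by
    intro b
    change (Algebra.ofId ℚ ℝ).mapMatrix (φ b) = _
    rw [AlgHom.mapMatrix_apply]
    rfl
  obtain ⟨u, hu⟩ := Literature.RingTheory.CentralSimple.exists_units_forall_algHom_eq_conj_of_isArtinianRing f ι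
  exact ⟨u, fun b => by rw [hu b, hf]⟩

include hO in
/-- The order `φ(O) ⊆ M₂(ℚ)`. [folklore] -/
theorem isOrder_map_algEquiv (φ : B ≃ₐ[ℚ] Matrix (Fin 2) (Fin 2) ℚ) :
    Brandt.IsOrder (Matrix (Fin 2) (Fin 2) ℚ)
      (O.map ((φ : B ≃+* Matrix (Fin 2) (Fin 2) ℚ).toAddEquiv.toIntLinearEquiv : B →ₗ[ℤ] Matrix (Fin 2) (Fin 2) ℚ)) :=
  hO.map_ringEquiv (φ : B ≃+* Matrix (Fin 2) (Fin 2) ℚ)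

/-- Membership in `φ(O)`: `x ∈ φ(O) ↔ φ⁻¹ x ∈ O`. [folklore] -/
theorem mem_map_algEquiv_iff (φ : B ≃ₐ[ℚ] Matrix (Fin 2) (Fin 2) ℚ) {x : Matrix (Fin 2) (Fin 2) ℚ} :
    x ∈ O.map ((φ : B ≃+* Matrix (Fin 2) (Fin 2) ℚ).toAddEquiv.toIntLinearEquiv : B →ₗ[ℤ] Matrix (Fin 2) (Fin 2) ℚ) ↔
      φ.symm x ∈ O :=
  mem_map_ringEquiv_iff (φ : B ≃+* Matrix (Fin 2) (Fin 2) ℚ)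

include hO in
/-- The lattice `g⁻¹ φ(O) g ⊆ M₂(ℤ)` contains `N · M₂(ℤ)` for some `N ≥ 1` (it is a full lattice and `M₂(ℤ)` is
finitely generated; tree `exists_smul_mem_of_fg`). [cite: VignerasLNM800, Ch. I §4 Lemme 4.6 and Ch. IV §1 Prop. 1.4 p. 105] -/
theorem exists_nsmul_mem_conj (φ : B ≃ₐ[ℚ] Matrix (Fin 2) (Fin 2) ℚ) (g : (Matrix (Fin 2) (Fin 2) ℚ)ˣ) :
    ∃ N : ℕ, 0 < N ∧ ∀ k ∈ (matrixOrder ℤ ℚ : Submodule ℤ (Matrix (Fin 2) (Fin 2) ℚ)),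
      φ.symm ((g : Matrix (Fin 2) (Fin 2) ℚ) * ((N : ℚ) • k) * ((g⁻¹ : (Matrix (Fin 2) (Fin 2) ℚ)ˣ) : Matrix (Fin 2) (Fin 2) ℚ)) ∈ O := by
  set O₀ := O.map ((φ : B ≃+* Matrix (Fin 2) (Fin 2) ℚ).toAddEquiv.toIntLinearEquiv : B →ₗ[ℤ] Matrix (Fin 2) (Fin 2) ℚ)
    with hO₀def
  have hO₀ : Brandt.IsOrder (Matrix (Fin 2) (Fin 2) ℚ) O₀ := isOrder_map_algEquiv hO φ
  have hfl : IsFullLattice (Matrix (Fin 2) (Fin 2) ℚ)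
      (O₀.map (unitsConj g⁻¹ : Matrix (Fin 2) (Fin 2) ℚ →ₗ[ℤ] Matrix (Fin 2) (Fin 2) ℚ)) :=
    hO₀.isFullLattice.map_unitsConj g⁻¹
  have hfg : (matrixOrder ℤ ℚ : Submodule ℤ (Matrix (Fin 2) (Fin 2) ℚ)).FG :=
    (isZOrder_iff_isOrder.mp isZOrder_matrixOrder_rat).isFullLattice.1
  obtain ⟨n, hn0, hn⟩ := exists_smul_mem_of_fg hfl hfg
  refine ⟨n.natAbs, Int.natAbs_pos.mpr hn0, fun k hk => ?_⟩
  have h1 : n • k ∈ O₀.map (unitsConj g⁻¹ : Matrix (Fin 2) (Fin 2) ℚ →ₗ[ℤ] Matrix (Fin 2) (Fin 2) ℚ) := hn k hk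
  have h2 : (n.natAbs : ℤ) • k ∈ O₀.map (unitsConj g⁻¹ : Matrix (Fin 2) (Fin 2) ℚ →ₗ[ℤ] Matrix (Fin 2) (Fin 2) ℚ) := by
    rcases Int.natAbs_eq n with h' | h'
    · rwa [← h']
    · have h3 : (n.natAbs : ℤ) = -n := by omega
      rw [h3, neg_smul]
      exact Submodule.neg_mem _ h1
  rw [mem_map_unitsConj_iff, inv_inv] at h2
  rw [← mem_map_algEquiv_iff φ]
  have e : (n.natAbs : ℚ) • k = (n.natAbs : ℤ) • k := by
    rw [Nat.cast_smul_eq_nsmul, natCast_zsmul]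
  rw [e]
  exact h2


/-- **CONJUGATION FORMULA**: with `ι = u φ(·) u⁻¹` and `gℝ` the real image of `g ∈ GL₂(ℚ)`,
`ι(φ⁻¹(g y g⁻¹)) = (u gℝ) · y_ℝ · (u gℝ)⁻¹`. [folklore] -/
theorem map_symm_conj_eq (φ : B ≃ₐ[ℚ] Matrix (Fin 2) (Fin 2) ℚ) (u : GL (Fin 2) ℝ)
    (hu : ∀ b : B, ι b = (u : Matrix (Fin 2) (Fin 2) ℝ) * (φ b).map (Rat.castHom ℝ) *
      ((u⁻¹ : GL (Fin 2) ℝ) : Matrix (Fin 2) (Fin 2) ℝ))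
    (g : (Matrix (Fin 2) (Fin 2) ℚ)ˣ) (y : Matrix (Fin 2) (Fin 2) ℚ) :
    ι (φ.symm ((g : Matrix (Fin 2) (Fin 2) ℚ) * y * ((g⁻¹ : (Matrix (Fin 2) (Fin 2) ℚ)ˣ) : Matrix (Fin 2) (Fin 2) ℚ))) =
      ((u * Matrix.GeneralLinearGroup.map (Rat.castHom ℝ) g : GL (Fin 2) ℝ) : Matrix (Fin 2) (Fin 2) ℝ) *
        y.map (Rat.castHom ℝ) *
        (((u * Matrix.GeneralLinearGroup.map (Rat.castHom ℝ) g)⁻¹ : GL (Fin 2) ℝ) : Matrix (Fin 2) (Fin 2) ℝ) := by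
  rw [hu, AlgEquiv.apply_symm_apply, Matrix.map_mul, Matrix.map_mul, mul_inv_rev, Units.val_mul, Units.val_mul, ← map_inv]
  have e1 : ((Matrix.GeneralLinearGroup.map (Rat.castHom ℝ) g : GL (Fin 2) ℝ) : Matrix (Fin 2) (Fin 2) ℝ) =
      (g : Matrix (Fin 2) (Fin 2) ℚ).map (Rat.castHom ℝ) := rfl
  have e2 : ((Matrix.GeneralLinearGroup.map (Rat.castHom ℝ) g⁻¹ : GL (Fin 2) ℝ) : Matrix (Fin 2) (Fin 2) ℝ) =
      ((g⁻¹ : (Matrix (Fin 2) (Fin 2) ℚ)ˣ) : Matrix (Fin 2) (Fin 2) ℚ).map (Rat.castHom ℝ) := rfl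
  rw [e1, e2]
  simp only [mul_assoc]

include hO in
/-- **THE SPLIT DICTIONARY.** If `B` has a non-zero non-unit, there are `h ∈ GL₂(ℝ)` with `det h > 0` and `N ≥ 1` such that
(i) every element of `Γ = ι(O¹)` is `h t h⁻¹` with `t ∈ SL₂(ℤ)`, and (ii) `h s h⁻¹ ∈ Γ` for every `s ∈ Γ(M)`, `N ∣ M`.
(`φ : B ≅ M₂(ℚ)`, Skolem–Noether `ι = u φ u⁻¹`, `φ(O) ⊆ g M₂(ℤ) g⁻¹ ⊇ … ⊇ N M₂(ℤ)`-containment, `h = u g`.)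
[cite: ShimuraIATAF1971, §9.2 p. 246; Prop. 1.19] [cite: VignerasLNM800, Ch. IV §1 Thm. 1.1 p. 104, Prop. 1.4 p. 105]
[cite: BourbakiAlgebreVIII2012, VIII §14 n°3 Th. 2 (p. A VIII.252)] -/
theorem exists_conj_normOneUnits_dictionary [IsQuaternionAlgebra ℚ B] (hsplit : ∃ x : B, x ≠ 0 ∧ ¬ IsUnit x) :
    ∃ (h : GL (Fin 2) ℝ) (N : ℕ), 0 < h.det.val ∧ 0 < N ∧
      (∀ γ ∈ normOneUnits ι hO, ∃ t : SL(2, ℤ), γ = h * Matrix.SpecialLinearGroup.mapGL ℝ t * h⁻¹) ∧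
      ∀ M : ℕ, N ∣ M → ∀ s ∈ CongruenceSubgroup.Gamma M,
        h * Matrix.SpecialLinearGroup.mapGL ℝ s * h⁻¹ ∈ normOneUnits ι hO := by
  classical
  obtain ⟨φ⟩ := nonempty_algEquiv_matrix_of_exists_not_isUnit hsplit
  obtain ⟨u, hu⟩ := exists_units_forall_eq_conj_map ι φ
  set O₀ := O.map ((φ : B ≃+* Matrix (Fin 2) (Fin 2) ℚ).toAddEquiv.toIntLinearEquiv : B →ₗ[ℤ] Matrix (Fin 2) (Fin 2) ℚ)
    with hO₀def
  have hO₀ : Brandt.IsOrder (Matrix (Fin 2) (Fin 2) ℚ) O₀ := isOrder_map_algEquiv hO φ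
  obtain ⟨g₀, hg₀⟩ := hO₀.exists_le_map_unitsConj_matrixOrder
  obtain ⟨g, hg, hdet⟩ := exists_le_map_unitsConj_det_pos u hg₀
  obtain ⟨N, hN, hNmem⟩ := exists_nsmul_mem_conj hO φ g
  -- shorthand
  have hmapGL : ∀ t : SL(2, ℤ), ((Matrix.SpecialLinearGroup.mapGL ℝ t : GL (Fin 2) ℝ) : Matrix (Fin 2) (Fin 2) ℝ) =
      ((t : Matrix (Fin 2) (Fin 2) ℤ).map (Int.cast : ℤ → ℚ)).map (Rat.castHom ℝ) := by
    intro t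
    rw [map_intCast_map_ratCast]
    rfl
  -- (B1) integral elements conjugate into `O`: `φ⁻¹(g (1 + N•k) g⁻¹) ∈ O`
  have hB1 : ∀ M : ℕ, N ∣ M → ∀ s ∈ CongruenceSubgroup.Gamma M,
      φ.symm ((g : Matrix (Fin 2) (Fin 2) ℚ) * ((s : Matrix (Fin 2) (Fin 2) ℤ).map (Int.cast : ℤ → ℚ)) *
        ((g⁻¹ : (Matrix (Fin 2) (Fin 2) ℚ)ˣ) : Matrix (Fin 2) (Fin 2) ℚ)) ∈ O := by
    intro M hNM s hs
    obtain ⟨c, rfl⟩ := hNM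
    obtain ⟨k, hk⟩ := exists_eq_one_add_nsmul_of_mem_Gamma hs
    have hk' : ((s : Matrix (Fin 2) (Fin 2) ℤ).map (Int.cast : ℤ → ℚ)) =
        1 + (N : ℚ) • ((c • k).map (Int.cast : ℤ → ℚ)) := by
      rw [hk, Matrix.map_add _ Int.cast_add, Matrix.map_one _ Int.cast_zero Int.cast_one, mul_smul,
        Matrix.map_smul (Int.cast : ℤ → ℚ) N (fun a => by simp), Nat.cast_smul_eq_nsmul]
    rw [hk', mul_add, add_mul, mul_one, Units.mul_inv, map_add, map_one]
    exact O.add_mem hO.one_mem (hNmem _ (map_intCast_mem_matrixOrder (c • k)))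
  -- (B2) the conjugation formula for `y = s_ℚ`
  have hB2 : ∀ s : SL(2, ℤ),
      ι (φ.symm ((g : Matrix (Fin 2) (Fin 2) ℚ) * ((s : Matrix (Fin 2) (Fin 2) ℤ).map (Int.cast : ℤ → ℚ)) *
        ((g⁻¹ : (Matrix (Fin 2) (Fin 2) ℚ)ˣ) : Matrix (Fin 2) (Fin 2) ℚ))) =
      ((u * Matrix.GeneralLinearGroup.map (Rat.castHom ℝ) g * Matrix.SpecialLinearGroup.mapGL ℝ s *
        (u * Matrix.GeneralLinearGroup.map (Rat.castHom ℝ) g)⁻¹ : GL (Fin 2) ℝ) : Matrix (Fin 2) (Fin 2) ℝ) := by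
    intro s
    rw [map_symm_conj_eq ι φ u hu g]
    simp only [Units.val_mul, hmapGL, mul_assoc]
  refine ⟨u * Matrix.GeneralLinearGroup.map (Rat.castHom ℝ) g, N, hdet, hN, ?_, ?_⟩
  · -- (i) every `γ ∈ ι(O¹)` is `h t h⁻¹`, `t ∈ SL₂(ℤ)`
    intro γ hγ
    obtain ⟨⟨b, hb, hbγ⟩, -, hγdet⟩ := (mem_normOneUnits_iff ι hO).mp hγ
    have hφb : φ b ∈ O₀ := (mem_map_algEquiv_iff φ).mpr (by rw [AlgEquiv.symm_apply_apply]; exact hb)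
    have hy : (g⁻¹ : (Matrix (Fin 2) (Fin 2) ℚ)ˣ) * φ b * g ∈ (matrixOrder ℤ ℚ : Submodule ℤ (Matrix (Fin 2) (Fin 2) ℚ)) :=
      (mem_map_unitsConj_iff g _ _).mp (hg hφb)
    obtain ⟨Y, hY⟩ := exists_eq_map_intCast_of_mem_matrixOrder hy
    have hconj : φ b = (g : Matrix (Fin 2) (Fin 2) ℚ) * Y.map (Int.cast : ℤ → ℚ) *
        ((g⁻¹ : (Matrix (Fin 2) (Fin 2) ℚ)ˣ) : Matrix (Fin 2) (Fin 2) ℚ) := by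
      rw [← hY, ← mul_assoc, ← mul_assoc, Units.mul_inv, one_mul, mul_assoc, Units.mul_inv, mul_one]
    have hγmat : (γ : Matrix (Fin 2) (Fin 2) ℝ) =
        ((u * Matrix.GeneralLinearGroup.map (Rat.castHom ℝ) g : GL (Fin 2) ℝ) : Matrix (Fin 2) (Fin 2) ℝ) *
          (Y.map (Int.cast : ℤ → ℚ)).map (Rat.castHom ℝ) *
          (((u * Matrix.GeneralLinearGroup.map (Rat.castHom ℝ) g)⁻¹ : GL (Fin 2) ℝ) : Matrix (Fin 2) (Fin 2) ℝ) := by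
      rw [← hbγ, ← map_symm_conj_eq ι φ u hu g, ← hconj, AlgEquiv.symm_apply_apply]
    have hYdet : Y.det = 1 := by
      have h1 : ((Y.map (Int.cast : ℤ → ℚ)).map (Rat.castHom ℝ)).det = 1 := by
        have := congr_arg Matrix.det hγmat
        rw [Matrix.det_mul, Matrix.det_mul, mul_right_comm, ← Matrix.det_mul, ← Units.val_mul, mul_inv_cancel,
          Units.val_one, Matrix.det_one, one_mul, ← Matrix.GeneralLinearGroup.val_det_apply, hγdet, Units.val_one] at this
        exact this.symm
      rw [map_intCast_map_ratCast, algebraMap_int_eq, ← RingHom.mapMatrix_apply, ← RingHom.map_det, eq_intCast] at h1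
      exact_mod_cast h1
    refine ⟨⟨Y, hYdet⟩, Units.ext ?_⟩
    rw [hγmat]
    simp only [Units.val_mul, hmapGL, mul_assoc]
  · -- (ii) `h s h⁻¹ ∈ ι(O¹)` for `s ∈ Γ(M)`, `N ∣ M`
    intro M hNM s hs
    rw [mem_normOneUnits_iff]
    refine ⟨⟨_, hB1 M hNM s hs, hB2 s⟩, ⟨_, hB1 M hNM s⁻¹ (Subgroup.inv_mem _ hs), ?_⟩, ?_⟩
    · rw [hB2 s⁻¹]
      congr 1
      rw [map_inv]
      group
    · rw [map_mul, map_mul, map_inv, mul_inv_cancel_comm, Matrix.SpecialLinearGroup.det_mapGL]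

end Split

/-! ## §3 The reduction theorems -/

section Main

/-- **(ESᶜ-surj-split) ⟸ ES-surj-par(`Γ(M)`) on a cofinal set of levels.** If for every `N ≥ 1` some multiple `M` of `N` has
the property «every additive parabolic-null `u : Γ(M) → ℝ` is the real period cochain of a weight-two cusp form on `Γ(M)`»
(surjectivity in Shimura's Thm. 8.4, `n = 0`, for the principal congruence subgroup `Γ(M) ≤ SL₂(ℤ)` — the modular curve `X(M)`),
then the residue `eichlerShimura_weightTwo_rePeriod_surjective_of_exists_not_isUnit` holds: transport along `h Γ(M) h⁻¹`
(`esSurjPar_conjAct_smul`) and normal finite-index descent by averaging (`esSurjPar_of_normal_finiteIndex`).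
[cite: ShimuraIATAF1971, Thm. 8.4 p. 234 with (8.2.19)–(8.2.20); §9.2 p. 246; Prop. 1.19] -/
theorem eichlerShimura_weightTwo_rePeriod_surjective_of_exists_not_isUnit_of_Gamma
    (hΓ : ∀ N : ℕ, 0 < N → ∃ M : ℕ, 0 < M ∧ N ∣ M ∧
      (∀ (z₀ : UpperHalfPlane) (u : ↥((CongruenceSubgroup.Gamma M).map (Matrix.SpecialLinearGroup.mapGL ℝ)) → ℝ), (∀ γ δ : ↥((CongruenceSubgroup.Gamma M).map (Matrix.SpecialLinearGroup.mapGL ℝ)), u (γ * δ) = u γ + u δ) →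
      (∀ γ : ↥((CongruenceSubgroup.Gamma M).map (Matrix.SpecialLinearGroup.mapGL ℝ)), (γ : GL (Fin 2) ℝ).IsParabolic → u γ = 0) →
      ∃ F : CuspForm ((CongruenceSubgroup.Gamma M).map (Matrix.SpecialLinearGroup.mapGL ℝ)) 2, ∀ γ : ↥((CongruenceSubgroup.Gamma M).map (Matrix.SpecialLinearGroup.mapGL ℝ)), CuspForm.rePeriod F z₀ γ = u γ)) :
    eichlerShimura_weightTwo_rePeriod_surjective_of_exists_not_isUnit := by
  intro B _ _ _ O hO ι _hι hsplit z₀ u hu hpar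
  obtain ⟨h, N, hdet, hN, hrep, hmem⟩ := exists_conj_normOneUnits_dictionary hO ι hsplit
  obtain ⟨M, hM, hNM, hES⟩ := hΓ N hN
  obtain ⟨hle, hNormal, hfi⟩ := conj_Gamma_le_normal_finiteIndex hM hrep (hmem M hNM)
  exact esSurjPar_of_normal_finiteIndex hle hNormal hfi (esSurjPar_conjAct_smul hES hdet) z₀ u hu hpar

/-- **(ESᶜ-surj-split) ⟸ ES-surj-par(`Γ(N)`) for all `N ≥ 3`** (the torsion-free principal levels; take `M = 3N`).
[cite: ShimuraIATAF1971, Thm. 8.4 p. 234; §1.6 p. 22 (Γ(N) torsion-free for N ≥ 3); §9.2 p. 246] -/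
theorem eichlerShimura_weightTwo_rePeriod_surjective_of_exists_not_isUnit_of_Gamma_three_le
    (hΓ : ∀ M : ℕ, 3 ≤ M →
      (∀ (z₀ : UpperHalfPlane) (u : ↥((CongruenceSubgroup.Gamma M).map (Matrix.SpecialLinearGroup.mapGL ℝ)) → ℝ), (∀ γ δ : ↥((CongruenceSubgroup.Gamma M).map (Matrix.SpecialLinearGroup.mapGL ℝ)), u (γ * δ) = u γ + u δ) →
      (∀ γ : ↥((CongruenceSubgroup.Gamma M).map (Matrix.SpecialLinearGroup.mapGL ℝ)), (γ : GL (Fin 2) ℝ).IsParabolic → u γ = 0) →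
      ∃ F : CuspForm ((CongruenceSubgroup.Gamma M).map (Matrix.SpecialLinearGroup.mapGL ℝ)) 2, ∀ γ : ↥((CongruenceSubgroup.Gamma M).map (Matrix.SpecialLinearGroup.mapGL ℝ)), CuspForm.rePeriod F z₀ γ = u γ)) :
    eichlerShimura_weightTwo_rePeriod_surjective_of_exists_not_isUnit :=
  eichlerShimura_weightTwo_rePeriod_surjective_of_exists_not_isUnit_of_Gamma fun N hN =>
    ⟨3 * N, by omega, Dvd.intro_left 3 rfl, hΓ (3 * N) (by omega)⟩

/-- **(ESᶜ-surj) ⟸ ES-surj-par(`Γ(N)`), `N ≥ 3`**: with the division-algebra half a theorem of the cell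
(`eichlerShimura_weightTwo_rePeriod_surjective_of_split`). [cite: ShimuraIATAF1971, Thm. 8.4 p. 234; §9.2 p. 246] -/
theorem eichlerShimura_weightTwo_rePeriod_surjective_of_Gamma_three_le
    (hΓ : ∀ M : ℕ, 3 ≤ M →
      (∀ (z₀ : UpperHalfPlane) (u : ↥((CongruenceSubgroup.Gamma M).map (Matrix.SpecialLinearGroup.mapGL ℝ)) → ℝ), (∀ γ δ : ↥((CongruenceSubgroup.Gamma M).map (Matrix.SpecialLinearGroup.mapGL ℝ)), u (γ * δ) = u γ + u δ) →
      (∀ γ : ↥((CongruenceSubgroup.Gamma M).map (Matrix.SpecialLinearGroup.mapGL ℝ)), (γ : GL (Fin 2) ℝ).IsParabolic → u γ = 0) →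
      ∃ F : CuspForm ((CongruenceSubgroup.Gamma M).map (Matrix.SpecialLinearGroup.mapGL ℝ)) 2, ∀ γ : ↥((CongruenceSubgroup.Gamma M).map (Matrix.SpecialLinearGroup.mapGL ℝ)), CuspForm.rePeriod F z₀ γ = u γ)) :
    eichlerShimura_weightTwo_rePeriod_surjective :=
  eichlerShimura_weightTwo_rePeriod_surjective_of_split
    (eichlerShimura_weightTwo_rePeriod_surjective_of_exists_not_isUnit_of_Gamma_three_le hΓ)

/-- **(ESᶜ) ⟸ ES-surj-par(`Γ(N)`), `N ≥ 3`**: the whole real Eichler–Shimura conjunct `eichlerShimura_weightTwo_rePeriod`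
(injectivity AND surjectivity for every order of every indefinite rational quaternion algebra) from the single modular-curve
input, the other three quarters being theorems in the tree (division injectivity/surjectivity: LEAD g27–g29, defn-ty1 g45;
split injectivity: `eichlerShimura_weightTwo_rePeriod_injective_of_exists_not_isUnit_holds`, bsd-idea-10 g22).
[cite: ShimuraIATAF1971, Thm. 8.4 p. 234; §9.2 p. 246] -/
theorem eichlerShimura_weightTwo_rePeriod_of_Gamma_three_le
    (hΓ : ∀ M : ℕ, 3 ≤ M →
      (∀ (z₀ : UpperHalfPlane) (u : ↥((CongruenceSubgroup.Gamma M).map (Matrix.SpecialLinearGroup.mapGL ℝ)) → ℝ), (∀ γ δ : ↥((CongruenceSubgroup.Gamma M).map (Matrix.SpecialLinearGroup.mapGL ℝ)), u (γ * δ) = u γ + u δ) →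
      (∀ γ : ↥((CongruenceSubgroup.Gamma M).map (Matrix.SpecialLinearGroup.mapGL ℝ)), (γ : GL (Fin 2) ℝ).IsParabolic → u γ = 0) →
      ∃ F : CuspForm ((CongruenceSubgroup.Gamma M).map (Matrix.SpecialLinearGroup.mapGL ℝ)) 2, ∀ γ : ↥((CongruenceSubgroup.Gamma M).map (Matrix.SpecialLinearGroup.mapGL ℝ)), CuspForm.rePeriod F z₀ γ = u γ)) :
    eichlerShimura_weightTwo_rePeriod :=
  eichlerShimura_weightTwo_rePeriod_of_cusp_residue' eichlerShimura_weightTwo_rePeriod_injective_of_exists_not_isUnit_holds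
    (eichlerShimura_weightTwo_rePeriod_surjective_of_exists_not_isUnit_of_Gamma_three_le hΓ)

end Main

/-! ## §4 From the NAMED modular-curve statement (ESᶜ-surj-Γ(M)) `eichlerShimura_weightTwo_rePeriod_surjective_Gamma` -/

section Named

/-- **(ESᶜ-surj-split) ⟸ (ESᶜ-surj-Γ(M))**: the residue from the named fact
`Literature.NumberTheory.Automorphic.eichlerShimura_weightTwo_rePeriod_surjective_Gamma` (Shimura Thm. 8.4, `n = 0`, `Ψ = 1`,
for `Γ = Γ(M)`, all `M ≥ 3`; defn-ty1 g45, p754197), whose body is the hypothesis of `…_of_Gamma_three_le` verbatim. [cite: ShimuraIATAF1971, Thm. 8.4 p. 234; §9.2 p. 246] -/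
theorem eichlerShimura_weightTwo_rePeriod_surjective_of_exists_not_isUnit_of_surjective_Gamma
    (h : eichlerShimura_weightTwo_rePeriod_surjective_Gamma) :
    eichlerShimura_weightTwo_rePeriod_surjective_of_exists_not_isUnit :=
  eichlerShimura_weightTwo_rePeriod_surjective_of_exists_not_isUnit_of_Gamma_three_le h

/-- **(ESᶜ-surj) ⟸ (ESᶜ-surj-Γ(M))**. [cite: ShimuraIATAF1971, Thm. 8.4 p. 234; §9.2 p. 246] -/
theorem eichlerShimura_weightTwo_rePeriod_surjective_of_surjective_Gamma
    (h : eichlerShimura_weightTwo_rePeriod_surjective_Gamma) :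
    eichlerShimura_weightTwo_rePeriod_surjective :=
  eichlerShimura_weightTwo_rePeriod_surjective_of_split
    (eichlerShimura_weightTwo_rePeriod_surjective_of_exists_not_isUnit_of_surjective_Gamma h)

/-- **(ESᶜ) ⟸ (ESᶜ-surj-Γ(M))**: the whole real Eichler–Shimura conjunct from surjectivity in Thm. 8.4 for the modular curves
`X(M)` alone. [cite: ShimuraIATAF1971, Thm. 8.4 p. 234; §9.2 p. 246] -/
theorem eichlerShimura_weightTwo_rePeriod_of_surjective_Gamma
    (h : eichlerShimura_weightTwo_rePeriod_surjective_Gamma) :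
    eichlerShimura_weightTwo_rePeriod :=
  eichlerShimura_weightTwo_rePeriod_of_cusp_residue' eichlerShimura_weightTwo_rePeriod_injective_of_exists_not_isUnit_holds
    (eichlerShimura_weightTwo_rePeriod_surjective_of_exists_not_isUnit_of_surjective_Gamma h)

end Named

end Summit.BirchSwinnertonDyer.BirchSwinnertonDyer.Theorems.EichlerShimuraCongruence

end
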